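import Mathlib
import Literature.Combinatorics.Optimization.ThreeRegularMatchingLpHardness
import HarnessLib

/-!
# The maximum matching problem has exponential LP formulation complexity (Braun–Pokutta–Zink 2015, Example 3.9)

G. Braun, S. Pokutta, D. Zink, *Inapproximability of combinatorial problems via small LPs and SDPs*, STOC 2015
[BraunPokuttaZink2015] (held `paper:arxiv-1410.8816`, §3.1.1 "The matching problem revisited", p. 11), **Example 3.9
(Maximum matching problem)**: "let the set `𝒮` of feasible solutions consist of all perfect matchings `M` of the complete
graph on `2n` vertices, and the instances be all (simple) graphs `G` on `[2n]` … `val_G(M) := |M ∩ E(G)|` … `max val_G`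
is the matching number `ν(G)` … For … `K_U` on the odd-sized set `U`, we have `max val_{K_U} = (|U|−1)/2` … the identity
`|U| = 2|M ∩ E(K_U)| + |M ∩ δ(U)|` and thus … the slack matrix for the exact problem (i.e., `C(G) = max val_G`)
`S(K_U, M) = (|U|−1)/2 − |M ∩ E(K_U)| = (|M ∩ δ(U)| − 1)/2`. This submatrix has nonnegative rank `2^{Ω(n)}` by [Rothvoss13]
and hence the LP formulation complexity of the maximum matching problem is `2^{Ω(n)}`, i.e., `fc(𝒫_Match) = 2^{Ω(n)}`."

PROVED here (no named facts), on top of `ThreeRegularMatchingLpHardness.lean` (which did the slack computation for the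
guarantee `⌊|V(H)|/2⌋ ≥ ν(H)` and fed it Rothvoss's theorem, a TREE THEOREM):

* `LPFormulation.ofLE` / `LPFormulation.isEmpty_ofLE` — weaker completeness guarantees inherit LP formulations (Def. 2.5:
  `w_𝔍(x) ≤ C(𝔍) ≤ C'(𝔍)`), so lower bounds for `C'` are lower bounds for `C ≤ C'`.
* `exactMatchingProblem G₀` — Example 3.9 with `C = S = max val = ν` (instances: the subgraphs of `G₀`; `G₀ = K_n` printed).
* `two_mul_matchingVal_le` (`2|M ∩ E(H)| ≤ |V(H)|`), `matchingOpt_le_half` (`ν(H) ≤ ⌊|V(H)|/2⌋`).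
* **`exactMatching_lpFormulation_exp`** — `fc(𝒫_Match) = 2^{Ω(n)}`: for some `c > 0`, all large even `n` and all
  `R ≤ 2^{cn}`, `IsEmpty (LPFormulation (exactMatchingProblem K_n) R)`; and, combined with [BraunPokuttaRoy2016, Thm. 5.1]'s
  reduction, **`exactThreeRegularMatching_lpFormulation_exp`** — the same over the `3`-regular graphs `D_N`
  (`ThreeRegularMatching.dGraph`), exponent `ck = Ω(√|V(D_N)|)`.  Both UNCONDITIONAL.

Not here: the approximate case "`(1 + ε/n)^{-1}`" of the example's last paragraph (rests on [BraunPokutta2014], not in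
the tree — see `ThreeRegularMatchingLpHardness.lean`).
-/

noncomputable section

open Finset Filter
open scoped Classical

namespace Literature.Combinatorics.Optimization

open Literature.Probability.LatticeModels (matchPartner adj_matchPartner eq_matchPartner_of_adj
  matchPartner_matchPartner)

/-! ### Guarantee monotonicity of LP formulations -/

section Mono

variable {σ φ : Type*} {R : ℕ}

/-- **Weaker guarantees inherit formulations**: if `𝒫'` has the same objective values as `𝒫`, every `𝒫'`-sound instance
is `𝒫`-sound, and `C ≤ C'` pointwise, then every `(C,S)`-approximate LP formulation of `𝒫` is a `(C',S')`-approximate LP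
formulation of `𝒫'` (same linear program, same realisations: `w_𝔍(x) ≤ C(𝔍) ≤ C'(𝔍)`).
[cite: BraunPokuttaZink2015, Def. 2.5] -/
def LPFormulation.ofLE {P P' : MaxProblem σ φ} (E : LPFormulation P R) (hval : ∀ f s, P'.val f s = P.val f s)
    (hsound : ∀ f, P'.Sound f → P.Sound f) (hC : ∀ f, P'.Sound f → P.C f ≤ P'.C f) : LPFormulation P' R where
  D := E.D
  A := E.A
  b := E.b
  x := E.x
  mem := E.mem
  w := E.w
  c := E.c
  exact f hf s := by rw [hval]; exact E.exact f (hsound f hf) s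
  achieves f hf y hy := (E.achieves f (hsound f hf) y hy).trans (hC f hf)

/-- Lower bounds for the weaker guarantee are lower bounds for the stronger one.
[cite: BraunPokuttaZink2015, Def. 2.5] -/
theorem LPFormulation.isEmpty_ofLE {P P' : MaxProblem σ φ} (hval : ∀ f s, P'.val f s = P.val f s)
    (hsound : ∀ f, P'.Sound f → P.Sound f) (hC : ∀ f, P'.Sound f → P.C f ≤ P'.C f)
    (h : IsEmpty (LPFormulation P' R)) : IsEmpty (LPFormulation P R) :=
  ⟨fun E => h.elim (E.ofLE hval hsound hC)⟩

end Mono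

/-! ### The exact maximum matching problem (Example 3.9) -/

section Exact

variable {V : Type*}

/-- **Example 3.9, the maximum matching problem `𝒫_Match`, EXACT version** (`C(G) = S(G) = max val_G = ν(G)`): feasible
solutions the perfect matchings `M` of `G₀` (printed: of `K_{2n}`), instances the subgraphs `G` (printed: all simple graphs
on `[2n]`), `val_G(M) = |M ∩ E(G)|` "the size of the matching `M ∩ E(G)` of `G` … `max val_G` is the matching number `ν(G)`".
[cite: BraunPokuttaZink2015, Ex. 3.9] -/
def exactMatchingProblem (G₀ : SimpleGraph V) : MaxProblem (PerfectMatching G₀) G₀.Subgraph where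
  val := matchingVal G₀
  C := matchingOpt G₀
  S := matchingOpt G₀

/-- Unfolding lemmas. [cite: BraunPokuttaZink2015, Ex. 3.9] -/
@[simp] theorem exactMatchingProblem_val (G₀ : SimpleGraph V) (H : G₀.Subgraph) (M : PerfectMatching G₀) :
    (exactMatchingProblem G₀).val H M = matchingVal G₀ H M := rfl

/-- `C = ν`. [cite: BraunPokuttaZink2015, Ex. 3.9] -/
@[simp] theorem exactMatchingProblem_C (G₀ : SimpleGraph V) (H : G₀.Subgraph) :
    (exactMatchingProblem G₀).C H = matchingOpt G₀ H := rfl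

/-- `S = ν`. [cite: BraunPokuttaZink2015, Ex. 3.9] -/
@[simp] theorem exactMatchingProblem_S (G₀ : SimpleGraph V) (H : G₀.Subgraph) :
    (exactMatchingProblem G₀).S H = matchingOpt G₀ H := rfl

variable [Fintype V]

/-- `2|M ∩ E(H)| ≤ |V(H)|`: the edges of a perfect matching inside `H` are disjoint and have both endpoints in `V(H)`
("`|U| = 2|M ∩ E(K_U)| + |M ∩ δ(U)|`" for cliques). [cite: BraunPokuttaZink2015, Ex. 3.9] -/
theorem two_mul_matchingVal_le {G₀ : SimpleGraph V} (H : G₀.Subgraph) (M : PerfectMatching G₀) :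
    2 * matchingVal G₀ H M ≤ (H.verts.ncard : ℝ) := by
  -- the injection `e ↦` its two endpoints: count vertices `x ∈ V(H)` whose partner is an `H`-neighbour
  have hff : ∀ x, matchPartner M.2 (matchPartner M.2 x) = x := matchPartner_matchPartner M.2
  set T := univ.filter fun x => H.Adj x (matchPartner M.2 x) with hT
  let g : V → Sym2 V := fun x => s(x, matchPartner M.2 x)
  have hset : M.1.edgeSet ∩ H.edgeSet ⊆ ↑(T.image g) := by
    intro e he
    obtain ⟨hM, hH⟩ := he
    simp only [coe_image, Set.mem_image, mem_coe, hT, mem_filter, mem_univ, true_and]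
    induction e using Sym2.ind with
    | h x y =>
      have hy : y = matchPartner M.2 x := eq_matchPartner_of_adj M.2 (SimpleGraph.Subgraph.mem_edgeSet.1 hM)
      subst hy
      exact ⟨x, SimpleGraph.Subgraph.mem_edgeSet.1 hH, rfl⟩
  -- each edge in the image has two distinct endpoints in `T`, and `T ⊆ V(H)`
  have hTV : T ⊆ univ.filter fun x => x ∈ H.verts := by
    intro x hx
    simp only [hT, mem_filter, mem_univ, true_and] at hx ⊢
    exact H.edge_vert hx
  have hfT : ∀ x ∈ T, matchPartner M.2 x ∈ T := fun x hx => by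
    simp only [hT, mem_filter, mem_univ, true_and] at hx ⊢
    rw [hff]; exact hx.symm
  -- `|image| * 2 ≤ |T|`: fibres have two elements
  have hmaps : Set.MapsTo g ↑T ↑(T.image g) := fun x hx => by
    simp only [coe_image]; exact Set.mem_image_of_mem g hx
  have hcardT : T.card = 2 * (T.image g).card := by
    rw [card_eq_sum_card_fiberwise hmaps]
    have hfib : ∀ e ∈ T.image g, (T.filter fun a => g a = e).card = 2 := by
      intro e he
      obtain ⟨a, ha, rfl⟩ := mem_image.1 he
      have hne : a ≠ matchPartner M.2 a := G₀.ne_of_adj (M.1.adj_sub (adj_matchPartner M.2 a))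
      have : (T.filter fun x => g x = g a) = {a, matchPartner M.2 a} := by
        ext x
        simp only [mem_filter, mem_insert, mem_singleton]
        constructor
        · rintro ⟨-, h⟩
          rcases Sym2.eq_iff.1 h with ⟨h1, -⟩ | ⟨h1, -⟩
          · exact Or.inl h1
          · exact Or.inr h1
        · rintro (rfl | rfl)
          · exact ⟨ha, rfl⟩
          · refine ⟨hfT a ha, ?_⟩
            show s(matchPartner M.2 a, matchPartner M.2 (matchPartner M.2 a)) = s(a, matchPartner M.2 a)
            rw [hff, Sym2.eq_swap]
      rw [this, card_pair hne]
    rw [sum_congr rfl hfib, sum_const, smul_eq_mul, mul_comm]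
  have h1 : (M.1.edgeSet ∩ H.edgeSet).ncard ≤ (T.image g).card := by
    rw [← Set.ncard_coe_finset]
    exact Set.ncard_le_ncard hset (Finset.finite_toSet _)
  have h2 : T.card ≤ (univ.filter fun x => x ∈ H.verts).card := card_le_card hTV
  have h3 : H.verts.ncard = (univ.filter fun x => x ∈ H.verts).card := by
    rw [← Set.ncard_coe_finset]; congr 1; ext v; simp
  rw [matchingVal, h3]
  have : 2 * (M.1.edgeSet ∩ H.edgeSet).ncard ≤ (univ.filter fun x => x ∈ H.verts).card := by omega
  exact_mod_cast this

/-- `ν(H) ≤ ⌊|V(H)|/2⌋`: the exact guarantee is below the guarantee `⌊|V(H)|/2⌋` of `matchingProblem G₀ 0`.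
[cite: BraunPokuttaZink2015, Ex. 3.9] -/
theorem matchingOpt_le_half {G₀ : SimpleGraph V} (H : G₀.Subgraph) :
    matchingOpt G₀ H ≤ ((H.verts.ncard / 2 : ℕ) : ℝ) := by
  unfold matchingOpt
  rcases isEmpty_or_nonempty (PerfectMatching G₀) with hE | hne
  · rw [Set.range_eq_empty, Real.sSup_empty]; positivity
  · refine csSup_le (Set.range_nonempty _) ?_
    rintro _ ⟨M, rfl⟩
    have h := two_mul_matchingVal_le H M
    have hnat : 2 * (M.1.edgeSet ∩ H.edgeSet).ncard ≤ H.verts.ncard := by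
      rw [matchingVal] at h; exact_mod_cast h
    have : (M.1.edgeSet ∩ H.edgeSet).ncard ≤ H.verts.ncard / 2 := by omega
    rw [matchingVal]; exact_mod_cast this

/-- Exact-matching lower bounds follow from the `(⌊|V(H)|/2⌋, OPT)` ones. [cite: BraunPokuttaZink2015, Ex. 3.9 and Def. 2.5] -/
theorem isEmpty_lpFormulation_exactMatching {G₀ : SimpleGraph V} {R : ℕ}
    (h : IsEmpty (LPFormulation (matchingProblem G₀ 0) R)) : IsEmpty (LPFormulation (exactMatchingProblem G₀) R) :=
  LPFormulation.isEmpty_ofLE (P := exactMatchingProblem G₀) (P' := matchingProblem G₀ 0) (fun _ _ => rfl)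
    (fun _ _ => matchingProblem_sound G₀ 0 _ |> fun hs => fun M => hs M) (fun H _ => by
      rw [exactMatchingProblem_C, matchingProblem_C, add_zero]; exact matchingOpt_le_half H) h

/-- **Example 3.9: `fc(𝒫_Match) = 2^{Ω(n)}`** — "This submatrix has nonnegative rank `2^{Ω(n)}` by [Rothvoss13] and hence the
LP formulation complexity of the maximum matching problem is `2^{Ω(n)}`": for some `c > 0` and all large even `n`, the exact
maximum matching problem over `K_n` has no LP formulation of size `≤ 2^{cn}`.  UNCONDITIONAL (Rothvoss's theorem is the tree
theorem `rothvoss_matching_slack_bound_holds`; via `matchingKn_lpFormulation_exp`).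
[cite: BraunPokuttaZink2015, Ex. 3.9] [cite: Rothvoss2017, Thm. 1] -/
theorem exactMatching_lpFormulation_exp :
    ∃ c : ℝ, 0 < c ∧ ∀ᶠ n : ℕ in atTop, Even n → ∀ R : ℕ, (R : ℝ) ≤ 2 ^ (c * n) →
      IsEmpty (LPFormulation (exactMatchingProblem (⊤ : SimpleGraph (Fin n))) R) := by
  obtain ⟨c, hc, hev⟩ := matchingKn_lpFormulation_exp
  exact ⟨c, hc, hev.mono fun n hn heven R hR => isEmpty_lpFormulation_exactMatching (hn heven R hR)⟩

/-- **Exact matching over the `3`-regular graphs `D_N`** (Braun–Pokutta–Roy Thm. 5.1 combined with Example 3.9): for some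
`c > 0`, all large even `k` and `R ≤ 2^{ck}`, the exact maximum matching problem over `D_{k+2}` (`3`-regular,
`(k+2)(k+1)` vertices) has no LP formulation of size `R`. [cite: BraunPokuttaRoy2016, Thm. 5.1 (arXiv v3)]
[cite: BraunPokuttaZink2015, Ex. 3.9] -/
theorem exactThreeRegularMatching_lpFormulation_exp :
    ∃ c : ℝ, 0 < c ∧ ∀ᶠ k : ℕ in atTop, Even k → ∀ R : ℕ, (R : ℝ) ≤ 2 ^ (c * k) →
      IsEmpty (LPFormulation (exactMatchingProblem (ThreeRegularMatching.dGraph k)) R) := by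
  obtain ⟨c, hc, hev⟩ := ThreeRegularMatching.threeRegularMatching_lpFormulation_exp
  exact ⟨c, hc, hev.mono fun k hk heven R hR => isEmpty_lpFormulation_exactMatching (hk heven R hR)⟩

end Exact

end Literature.Combinatorics.Optimization

end
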